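import Summits.Langlands.Langlands.Statement
import HarnessLib

/-!
# SKELETON — line `split-x3-weak-automorphy` for the crux `ReciprocityUpToIrreducibility` (item stmt-Langlands-14328;
routes OrdinaryPrimeTransport / IrreducibilityBySelfDuality), crux-strategist planner-cstrat-stmt-Langlands-14328-r1-0

Plan for piece X₃ `WeakAutomorphy` (crux; child of the split `directional-split`): Galois → automorphic a.e.
by Taylor's paradigm POTENTIAL AUTOMORPHY + DESCENT:

* `stub_potentialWeakAutomorphy` — an irreducible pinned-geometric ρ : Γ_K → GL_n(ℚ̄_ℓ) becomes cuspidal-automorphic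
  a.e. over some finite SOLVABLE Galois extension F'/K (potential automorphy: Taylor 2002/2006, HSBT 2010, BLGGT 2014
  Thm C / Cor 4.5.2 for regular polarizable ρ — over CM/TR F' that is Galois over a subfield but NOT known solvable;
  ACC+ 2018 / Qian for non-polarizable regular over CM; open in general, and the solvability of F' is the extra bet);
* `stub_solvableDescentAE` — automorphy a.e. of an irreducible geometric ρ DESCENDS along solvable Galois extensions
  (cyclic prime-degree steps: Arthur–Clozel 1989 Thm III.4.2 base change/descent for GL_n + strong multiplicity one;
  a theorem when the automorphic representation upstairs has attached Galois representations — regular algebraic,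
  BLGHT 2011 Lemma 1.4-type arguments —, open in general: the descended π must be matched with ρ a.e. up to a
  character twist without Galois representations on the automorphic side).

Composition `WeakAutomorphy_of` = descent ∘ potential automorphy.  Neither stub is B_w: the first allows a field
extension, the second assumes potential automorphy.  Stubs are the ONLY sorries.
-/

noncomputable section
set_option linter.dupNamespace false

namespace Summit.Langlands.Langlands.Cruxes.ReciprocityUpToIrreducibility.SplitX3

open scoped NumberField Classical Polynomial BigOperators
open Filter IsDedekindDomain Polynomial
open Literature.NumberTheory.Automorphic Literature.NumberTheory.GaloisRepresentations
open Summit.Langlands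

/-- Piece X₃, verbatim as filed. -/
def WeakAutomorphy : Prop :=
  ∀ (K : Type) [Field K] [NumberField K] (n : ℕ) (hcpt : Literature.NumberTheory.Automorphic.isCompact_glFiniteIntegralLevel n K), 0 < n → ∀ (ℓ : ℕ) [Fact ℓ.Prime] (ι : PadicAlgCl ℓ ≃+* ℂ) (ρ : Literature.NumberTheory.GaloisRepresentations.FramedGaloisRep K (PadicAlgCl ℓ) n), ρ.toGaloisRep.IsIrreducible → ((∀ᶠ v : IsDedekindDomain.HeightOneSpectrum (NumberField.RingOfIntegers K) in Filter.cofinite, ρ.IsUnramifiedAt v) ∧ ∀ (v : IsDedekindDomain.HeightOneSpectrum (NumberField.RingOfIntegers K)) (hv : ((ℓ : ℕ) : NumberField.RingOfIntegers K) ∈ v.asIdeal), (Literature.NumberTheory.PAdicHodge.fontainePstAdicCompletion v ℓ hv).IsDeRhamFramed (ρ.toLocal v)) → ∃ π : Literature.NumberTheory.Automorphic.CuspidalAutomorphicRepData n K hcpt, π.1.IsLAlgebraic ∧ ∀ᶠ v : IsDedekindDomain.HeightOneSpectrum (NumberField.RingOfIntegers K) in Filter.cofinite, Summit.Langlands.SatakeFrobCompatibleAt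 ι π.1 ρ v

/-- **Potential weak automorphy over a SOLVABLE Galois extension (OPEN; Taylor/HSBT/BLGGT potential automorphy in the regular polarizable case, ACC+/Qian non-polarizable over CM; solvability of F' is the bet).** [cite: doi:10.4007/annals.2014.179.2.3, Thm. C] [cite: arXiv:1812.09999, Thm. 6.1.1] -/
theorem stub_potentialWeakAutomorphy :
    ∀ (K : Type) [Field K] [NumberField K] (n : ℕ) (hcpt : Literature.NumberTheory.Automorphic.isCompact_glFiniteIntegralLevel n K), 0 < n → ∀ (ℓ : ℕ) [Fact ℓ.Prime] (ι : PadicAlgCl ℓ ≃+* ℂ) (ρ : Literature.NumberTheory.GaloisRepresentations.FramedGaloisRep K (PadicAlgCl ℓ) n), ρ.toGaloisRep.IsIrreducible → ((∀ᶠ v : IsDedekindDomain.HeightOneSpectrum (NumberField.RingOfIntegers K) in Filter.cofinite, ρ.IsUnramifiedAt v) ∧ ∀ (v : IsDedekindDomain.HeightOneSpectrum (NumberField.RingOfIntegers K)) (hv : ((ℓ : ℕ) : NumberField.RingOfIntegers K) ∈ v.asIdeal), (Literature.NumberTheory.PAdicHodge.fontainePstAdicCompletion v ℓ hv).IsDeRhamFramed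 (ρ.toLocal v)) → ∃ (F' : Type) (_ : Field F') (_ : NumberField F') (_ : Algebra K F') (_ : IsGalois K F'), IsSolvable (F' ≃ₐ[K] F') ∧ ∃ (h' : Literature.NumberTheory.Automorphic.isCompact_glFiniteIntegralLevel n F') (π' : Literature.NumberTheory.Automorphic.CuspidalAutomorphicRepData n F' h'), π'.1.IsLAlgebraic ∧ ∀ᶠ w : IsDedekindDomain.HeightOneSpectrum (NumberField.RingOfIntegers F') in Filter.cofinite, Summit.Langlands.SatakeFrobCompatibleAt ι π'.1 (ρ.restrictField F') w := by
  sorry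

/-- **Solvable descent of automorphy a.e. for an irreducible geometric ρ (OPEN in general; Arthur–Clozel cyclic base change Thm III.4.2 + strong multiplicity one; a theorem in regular settings, BLGHT 2011 Lemma 1.4).** [cite: ArthurClozelAMS120, Ch. 3 Thm. 4.2] [cite: doi:10.2977/PRIMS/31, Lemma 1.4] -/
theorem stub_solvableDescentAE :
    ∀ (K : Type) [Field K] [NumberField K] (n : ℕ) (hcpt : Literature.NumberTheory.Automorphic.isCompact_glFiniteIntegralLevel n K), 0 < n → ∀ (ℓ : ℕ) [Fact ℓ.Prime] (ι : PadicAlgCl ℓ ≃+* ℂ) (ρ : Literature.NumberTheory.GaloisRepresentations.FramedGaloisRep K (PadicAlgCl ℓ) n), ρ.toGaloisRep.IsIrreducible → ((∀ᶠ v : IsDedekindDomain.HeightOneSpectrum (NumberField.RingOfIntegers K) in Filter.cofinite, ρ.IsUnramifiedAt v) ∧ ∀ (v : IsDedekindDomain.HeightOneSpectrum (NumberField.RingOfIntegers K)) (hv : ((ℓ : ℕ) : NumberField.RingOfIntegers K) ∈ v.asIdeal), (Literature.NumberTheory.PAdicHodge.fontainePstAdicCompletion v ℓ hv).IsDeRhamFramed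 (ρ.toLocal v)) → (∃ (F' : Type) (_ : Field F') (_ : NumberField F') (_ : Algebra K F') (_ : IsGalois K F'), IsSolvable (F' ≃ₐ[K] F') ∧ ∃ (h' : Literature.NumberTheory.Automorphic.isCompact_glFiniteIntegralLevel n F') (π' : Literature.NumberTheory.Automorphic.CuspidalAutomorphicRepData n F' h'), π'.1.IsLAlgebraic ∧ ∀ᶠ w : IsDedekindDomain.HeightOneSpectrum (NumberField.RingOfIntegers F') in Filter.cofinite, Summit.Langlands.SatakeFrobCompatibleAt ι π'.1 (ρ.restrictField F') w) → ∃ π : Literature.NumberTheory.Automorphic.CuspidalAutomorphicRepData n K hcpt, π.1.IsLAlgebraic ∧ ∀ᶠ v : IsDedekindDomain.HeightOneSpectrum (NumberField.RingOfIntegers K) in Filter.cofinite, Summit.Langlands.SatakeFrobCompatibleAt ι π.1 ρ v := by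
  sorry

/-- **COMPOSITION — piece X₃ from the two stubs** (descent ∘ potential automorphy). -/
theorem WeakAutomorphy_of : WeakAutomorphy :=
  fun K _ _ n hcpt hn ℓ _ ι ρ hirr hgeo =>
    stub_solvableDescentAE K n hcpt hn ℓ ι ρ hirr hgeo (stub_potentialWeakAutomorphy K n hcpt hn ℓ ι ρ hirr hgeo)

end Summit.Langlands.Langlands.Cruxes.ReciprocityUpToIrreducibility.SplitX3

end
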